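import Summits.ABC.IUTFork.Conditional.AbcOfSGenuineKWindowDatum
import HarnessLib

/-!
# R-H C2 PLACE-CUT glue, part III: inside the WINDOW every bad place over an odd prime has an explicit
# TOP-LABEL HEIGHT CEILING `H_win(l, p, [K:ℚ], e)` — so an in-window PLACE-cut by height is automatic

PROOF-ONLY support piece (0 definitions, 0 `Prop` facts) by abc-iut-rp-j2 (gen 4; D-0079 R-H k2 hand, C2 row), sequel of
`Repair.RHPlaceCutGlue` (p455810) / `Repair.RHPlaceCutCertificate` (p456095); GO abc-iut-rh-lead 2026-08-26T16:36:05Z. No side taken on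
[IUTchIII] Cor. 3.12 or on any author; candidates are hypotheses; typed ≠ proved. This file is classical `log_p` bookkeeping on the typed
depth locus of the window certificates — nothing disputed is used or asserted.

THE OBJECT. The window certificates of branch C (`Conditional.abc_of_SH_v8K/v9K/v10K_window[…]`, p444039 / p445646 / p450130) split every
admissible datum by the degree-form DEPTH LOCUS
  `Deep(T) :⟺ ∃ p > 2, i, x₀ | p : p^{((i+2)(4+2·log_p[K:ℚ]))+1} · ‖t_q(x₀)‖^{(i+1)²−1} < 1`
(chosen realising q-idele), which abc-iut-C-cert-2's `GenuineK.deep_iff_deepOrd` (p445646) rewrites as the DATUM-ONLY locus `DeepOrd(T)` with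
`‖t_q(x₀)‖ = p^{ord_{x₀}(j_E)/(2l·e_{x₀})}` at a BAD place `x₀` (abc-iut-w4-d026 `Cor312Prov.norm_chosenQIdele_eq_rpow_ord_jE`). Write
`H_{x₀} := −ord_{x₀}(j_E) = ord_{x₀}(q_E) > 0` (the local height at the bad place), `e_{x₀} := e(x₀|p)`, `N := [K:ℚ]`, `c_p := 4 + 2·log_p N`,
`j := i + 1 ∈ {1, …, l⋇}`.

WHAT IS PROVED (namespace `Summit.ABC.IUTFork.Repair.RHPlaceCutHeightCeiling`):
* §0 `rpow_mul_rpow_div_pow_lt_one_iff` — for `1 < p`, `0 < d`: `p^A · (p^{B/d})^n < 1 ⟺ d·A + n·B < 0` (pure real bookkeeping).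
* §1 `deepCell_iff_height_gt` — ONE CELL of `DeepOrd` in log form: the cell `(p, i, x₀)` is deep ⟺ `2l·e_{x₀}·((j+1)·c_p + 1) < (j²−1)·H_{x₀}`.
* §1 `height_le_of_not_deepOrd` / `height_le_of_not_deep` — **WINDOW ⟹ PER-CELL HEIGHT CEILING**: if the datum is NOT deep (either form), then at
  every bad place `x₀ | p > 2` and every label `j`: `(j²−1)·H_{x₀} ≤ 2l·e_{x₀}·((j+1)·c_p + 1)`.
* §2 `height_le_top_of_not_deepOrd` / `…_of_not_deep` — the TOP LABEL `j = l⋇` (the binding one, since `((j+1)c+1)/(j²−1)` decreases in `j`):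
  `(l⋇²−1)·H_{x₀} ≤ 2l·e_{x₀}·((l⋇+1)·c_p + 1)`, and the divided form `height_le_ceiling_of_not_deepOrd`:
  `H_{x₀} ≤ H_win := 2l·e_{x₀}·((l⋇+1)·c_p + 1)/(l⋇²−1)`; in terms of `l = 2l⋇+1` the coarser closed form `height_le_of_not_deepOrd_l`:
  `(l−3)·H_{x₀} ≤ 4l·e_{x₀}·(5 + 2·log_p N)` (so `H_{x₀}/e_{x₀} ≤ 4l(c_p+1)/(l−3)`, `→ 4(c_p+1)` as `l → ∞`).
* §3 `placeCut_total_of_not_deepOrd` — the R-H reading in one sentence: inside the window, a PLACE-cut hypothesis «`Q` only at the bad places with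
  `H_{x₀} ≤ H₀·e_{x₀}`-type bound» whose threshold dominates `H_win` is NO CUT AT ALL — it yields `Q` at every bad place over every odd prime.
READING FOR R-H (C2 row; memo HOME/staging/RH/rp-j2/C2-GLUE-MEMO.md): a height PLACE-cut `H⋆ := «I06⋆ only where H ≤ H₀»` with `H₀ ≥ H_win` coincides
with `I06⋆` on the window (k4-type: no room), and with `H₀ < H_win` it needs (Ind2)-movers at the places `H₀ < H ≤ H_win` from elsewhere; the converse
direction «`H ≤ 16·e` everywhere ⟹ window» is abc-iut-w4-d078's T4 lemma B (`GenuineK.not_deepOrd_of_neg_ord_jE_le`, lane U) — not restated here.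
HONEST SCOPE: bad places over `p = 2` are not constrained (the locus quantifies `p > 2`, exactly as the certificates); `H_win` depends on the opaque
field `K` only through `[K:ℚ]` and `e(x₀|p)`; nothing here says which data ARE in the window. [cite: DupuyHilado2025, §3.3, §3.4]
[cite: Mochizuki2012, IUTchIV Prop. 1.2 p. 10, Thm. 1.10 p. 23]
-/

noncomputable section

open NumberField IsDedekindDomain

namespace Summit.ABC.IUTFork.Repair.RHPlaceCutHeightCeiling

open Thm311 Thm311.Real Cor312Prov Conditional Literature.IUT.LogVolume Literature.IUT.HodgeTheaters
open Literature.NumberTheory.DiophantineGeometry.GenEll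

/-! ## §0. The log form of one depth cell (pure real-number bookkeeping) -/

/-- For `1 < p` and `0 < d`: `p^A · (p^{B/d})^n < 1 ⟺ d·A + n·B < 0` (take `log_p` and clear the denominator).
[cite: DupuyHilado2025, §3.4] -/
theorem rpow_mul_rpow_div_pow_lt_one_iff {p A B d : ℝ} (hp : 1 < p) (hd : 0 < d) (n : ℕ) :
    p ^ A * (p ^ (B / d)) ^ n < 1 ↔ d * A + n * B < 0 := by
  have hp0 : 0 < p := lt_trans one_pos hp
  rw [← Real.rpow_natCast, ← Real.rpow_mul hp0.le, ← Real.rpow_add hp0]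
  conv_lhs => rw [← Real.rpow_zero p, Real.rpow_lt_rpow_left_iff hp]
  have key : d * (A + B / d * (n : ℝ)) = d * A + n * B := by
    field_simp
  constructor
  · intro h
    have h' := mul_neg_of_pos_of_neg hd h
    rwa [key] at h'
  · intro h
    have h' : d * (A + B / d * (n : ℝ)) < 0 := by rwa [key]
    rcases mul_neg_iff.mp h' with ⟨_, hx⟩ | ⟨hd', _⟩
    · exact hx
    · exact absurd hd' (not_lt.mpr hd.le)

/-! ## §1. Per datum: one cell in log form, and the window's per-cell height ceiling -/

section PerDatum

variable {F K Fbar : Type} [Field F] [NumberField F] [Field K] [NumberField K] [Algebra F K] [Field Fbar]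
  [Algebra F Fbar] [Algebra K Fbar] {E : WeierstrassCurve F} [E.IsElliptic] {l : ℕ} {Pb : BadPlacePredicates K}
  (D : InitialThetaData F K Fbar E l Pb)

/-- **One cell of `DeepOrd` in log form.** At a fibre point `x₀ | p` of the `K`-level pilot datum, the datum-only depth inequality of the
cell `(p, i, x₀)` (RHS of `GenuineK.deep_iff_deepOrd`) holds iff `2l·e_{x₀}·((i+2)(4+2·log_p[K:ℚ]) + 1) < ((i+1)²−1)·(−ord_{x₀}(j_E))`.
[cite: DupuyHilado2025, §3.3, §3.4] -/
theorem deepCell_iff_height_gt (pp : Nat.Primes) (i : Fin (thetaIndex (pilotDataOfK D K)).lstar)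
    (x₀ : (thetaIndex (pilotDataOfK D K)).Fibre (.inr pp)) :
    haveI : Fact (pp : ℕ).Prime := ⟨pp.2⟩
    (((pp : ℕ) : ℝ) ^ ((((i : ℕ) : ℝ) + 2) * (4 + 2 * Real.logb (pp : ℕ) (Module.finrank ℚ K)) + 1) *
        (((pp : ℕ) : ℝ) ^ ((ord K (placeOf (pilotDataOfK D K) pp.1 x₀) (algebraMap F K E.j) : ℝ) /
          (2 * l * ramIdx K (placeOf (pilotDataOfK D K) pp.1 x₀)))) ^ (((i : ℕ) + 1) ^ 2 - 1) < 1) ↔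
    (2 * l * ramIdx K (placeOf (pilotDataOfK D K) pp.1 x₀) : ℝ) *
        ((((i : ℕ) : ℝ) + 2) * (4 + 2 * Real.logb (pp : ℕ) (Module.finrank ℚ K)) + 1) <
      ((((i : ℕ) : ℝ) + 1) ^ 2 - 1) * -((ord K (placeOf (pilotDataOfK D K) pp.1 x₀) (algebraMap F K E.j) : ℤ) : ℝ) := by
  haveI : Fact (pp : ℕ).Prime := ⟨pp.2⟩
  have hp1 : (1 : ℝ) < ((pp : ℕ) : ℝ) := by exact_mod_cast pp.2.one_lt
  have hl : 0 < l := lt_of_lt_of_le (by norm_num) D.five_le_l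
  have he : 0 < ramIdx K (placeOf (pilotDataOfK D K) pp.1 x₀) := Nat.pos_of_ne_zero (ramIdx_ne_zero K _)
  have hd : (0 : ℝ) < 2 * l * ramIdx K (placeOf (pilotDataOfK D K) pp.1 x₀) := by
    have : (0 : ℝ) < (l : ℝ) := by exact_mod_cast hl
    have : (0 : ℝ) < (ramIdx K (placeOf (pilotDataOfK D K) pp.1 x₀) : ℝ) := by exact_mod_cast he
    positivity
  have hn : ((((i : ℕ) + 1) ^ 2 - 1 : ℕ) : ℝ) = (((i : ℕ) : ℝ) + 1) ^ 2 - 1 := by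
    rw [Nat.cast_sub (Nat.one_le_pow' 2 (i : ℕ)), Nat.cast_pow, Nat.cast_add, Nat.cast_one]
  rw [rpow_mul_rpow_div_pow_lt_one_iff hp1 hd, hn]
  constructor <;> intro h <;> linarith

/-- **WINDOW ⟹ PER-CELL HEIGHT CEILING (datum-only form).** If the `K`-level pilot datum is NOT on the datum-only depth locus `DeepOrd`
(RHS of `GenuineK.deep_iff_deepOrd`), then at every BAD place `x₀ | p` over an odd prime `p` and every label `j = i+1`:
`((i+1)²−1)·(−ord_{x₀}(j_E)) ≤ 2l·e_{x₀}·((i+2)(4+2·log_p[K:ℚ]) + 1)`. [cite: DupuyHilado2025, §3.3, §3.4]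
[cite: Mochizuki2012, IUTchIV Prop. 1.2 p. 10] -/
theorem height_le_of_not_deepOrd
    (hnd : ¬ (∃ (pp : Nat.Primes) (_ : 2 < (pp : ℕ)) (i : Fin (thetaIndex (pilotDataOfK D K)).lstar)
        (x₀ : (thetaIndex (pilotDataOfK D K)).Fibre (.inr pp)),
      haveI : Fact (pp : ℕ).Prime := ⟨pp.2⟩
      placeOf (pilotDataOfK D K) pp.1 x₀ ∈ (pilotDataOfK D K).S ∧
      ((pp : ℕ) : ℝ) ^ ((((i : ℕ) : ℝ) + 2) * (4 + 2 * Real.logb (pp : ℕ) (Module.finrank ℚ K)) + 1) *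
        (((pp : ℕ) : ℝ) ^ ((ord K (placeOf (pilotDataOfK D K) pp.1 x₀) (algebraMap F K E.j) : ℝ) /
          (2 * l * ramIdx K (placeOf (pilotDataOfK D K) pp.1 x₀)))) ^ (((i : ℕ) + 1) ^ 2 - 1) < 1))
    (pp : Nat.Primes) (hp2 : 2 < (pp : ℕ)) (i : Fin (thetaIndex (pilotDataOfK D K)).lstar)
    (x₀ : (thetaIndex (pilotDataOfK D K)).Fibre (.inr pp))
    (hw : haveI : Fact (pp : ℕ).Prime := ⟨pp.2⟩; placeOf (pilotDataOfK D K) pp.1 x₀ ∈ (pilotDataOfK D K).S) :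
    haveI : Fact (pp : ℕ).Prime := ⟨pp.2⟩
    ((((i : ℕ) : ℝ) + 1) ^ 2 - 1) * -((ord K (placeOf (pilotDataOfK D K) pp.1 x₀) (algebraMap F K E.j) : ℤ) : ℝ) ≤
      (2 * l * ramIdx K (placeOf (pilotDataOfK D K) pp.1 x₀) : ℝ) *
        ((((i : ℕ) : ℝ) + 2) * (4 + 2 * Real.logb (pp : ℕ) (Module.finrank ℚ K)) + 1) := by
  haveI : Fact (pp : ℕ).Prime := ⟨pp.2⟩
  by_contra h
  exact hnd ⟨pp, hp2, i, x₀, hw, (deepCell_iff_height_gt D pp i x₀).mpr (lt_of_not_ge h)⟩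

/-- **WINDOW ⟹ PER-CELL HEIGHT CEILING (certificate form).** The same ceiling from the window hypothesis AS THE CERTIFICATES WRITE IT — `¬ Deep`
on the CHOSEN realising q-idele (LHS of `GenuineK.deep_iff_deepOrd`; the `hSHw`/`hMovBad` window binder of `abc_of_SH_v8K/v10K_window[…]`,
`RHPlaceCutCertificate.abc_of_MOV_v10K_window_szpiroBadBoth`). [cite: DupuyHilado2025, §3.3, §3.4] [cite: Mochizuki2012, IUTchIV Prop. 1.2 p. 10] -/
theorem height_le_of_not_deep
    (hnd : ¬ (∃ (pp : Nat.Primes) (_ : 2 < (pp : ℕ)) (i : Fin (thetaIndex (pilotDataOfK D K)).lstar)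
        (x₀ : (thetaIndex (pilotDataOfK D K)).Fibre (.inr pp)),
      haveI : Fact (pp : ℕ).Prime := ⟨pp.2⟩
      ((pp : ℕ) : ℝ) ^ ((((i : ℕ) : ℝ) + 2) * (4 + 2 * Real.logb (pp : ℕ) (Module.finrank ℚ K)) + 1) *
        ‖(exists_realising_qIdeles_pilotDataOfK D).choose pp x₀‖ ^ (((i : ℕ) + 1) ^ 2 - 1) < 1))
    (pp : Nat.Primes) (hp2 : 2 < (pp : ℕ)) (i : Fin (thetaIndex (pilotDataOfK D K)).lstar)
    (x₀ : (thetaIndex (pilotDataOfK D K)).Fibre (.inr pp))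
    (hw : haveI : Fact (pp : ℕ).Prime := ⟨pp.2⟩; placeOf (pilotDataOfK D K) pp.1 x₀ ∈ (pilotDataOfK D K).S) :
    haveI : Fact (pp : ℕ).Prime := ⟨pp.2⟩
    ((((i : ℕ) : ℝ) + 1) ^ 2 - 1) * -((ord K (placeOf (pilotDataOfK D K) pp.1 x₀) (algebraMap F K E.j) : ℤ) : ℝ) ≤
      (2 * l * ramIdx K (placeOf (pilotDataOfK D K) pp.1 x₀) : ℝ) *
        ((((i : ℕ) : ℝ) + 2) * (4 + 2 * Real.logb (pp : ℕ) (Module.finrank ℚ K)) + 1) :=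
  height_le_of_not_deepOrd D (fun h => hnd ((GenuineK.deep_iff_deepOrd D).mpr h)) pp hp2 i x₀ hw

/-! ## §2. The top label `j = l⋇`: the per-place height ceiling `H_win(l, p, [K:ℚ], e)` -/

/-- **TOP-LABEL HEIGHT CEILING (datum-only window).** Inside the window, at every bad place `x₀ | p > 2`:
`(l⋇²−1)·(−ord_{x₀}(j_E)) ≤ 2l·e_{x₀}·((l⋇+1)(4+2·log_p[K:ℚ]) + 1)` — the cell `j = l⋇` of `height_le_of_not_deepOrd` (`l⋇ ≥ 2`).
[cite: DupuyHilado2025, §3.3, §3.4] [cite: Mochizuki2012, IUTchIV Prop. 1.2 p. 10] -/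
theorem height_le_top_of_not_deepOrd
    (hnd : ¬ (∃ (pp : Nat.Primes) (_ : 2 < (pp : ℕ)) (i : Fin (thetaIndex (pilotDataOfK D K)).lstar)
        (x₀ : (thetaIndex (pilotDataOfK D K)).Fibre (.inr pp)),
      haveI : Fact (pp : ℕ).Prime := ⟨pp.2⟩
      placeOf (pilotDataOfK D K) pp.1 x₀ ∈ (pilotDataOfK D K).S ∧
      ((pp : ℕ) : ℝ) ^ ((((i : ℕ) : ℝ) + 2) * (4 + 2 * Real.logb (pp : ℕ) (Module.finrank ℚ K)) + 1) *
        (((pp : ℕ) : ℝ) ^ ((ord K (placeOf (pilotDataOfK D K) pp.1 x₀) (algebraMap F K E.j) : ℝ) /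
          (2 * l * ramIdx K (placeOf (pilotDataOfK D K) pp.1 x₀)))) ^ (((i : ℕ) + 1) ^ 2 - 1) < 1))
    (pp : Nat.Primes) (hp2 : 2 < (pp : ℕ)) (x₀ : (thetaIndex (pilotDataOfK D K)).Fibre (.inr pp))
    (hw : haveI : Fact (pp : ℕ).Prime := ⟨pp.2⟩; placeOf (pilotDataOfK D K) pp.1 x₀ ∈ (pilotDataOfK D K).S) :
    haveI : Fact (pp : ℕ).Prime := ⟨pp.2⟩
    ((((pilotDataOfK D K).lstar : ℝ)) ^ 2 - 1) * -((ord K (placeOf (pilotDataOfK D K) pp.1 x₀) (algebraMap F K E.j) : ℤ) : ℝ) ≤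
      (2 * l * ramIdx K (placeOf (pilotDataOfK D K) pp.1 x₀) : ℝ) *
        ((((pilotDataOfK D K).lstar : ℝ) + 1) * (4 + 2 * Real.logb (pp : ℕ) (Module.finrank ℚ K)) + 1) := by
  haveI : Fact (pp : ℕ).Prime := ⟨pp.2⟩
  have h2 : 2 ≤ (pilotDataOfK D K).lstar := (pilotDataOfK D K).two_le_lstar
  have htop : (pilotDataOfK D K).lstar - 1 < (thetaIndex (pilotDataOfK D K)).lstar := by
    show (pilotDataOfK D K).lstar - 1 < (pilotDataOfK D K).lstar
    omega
  have h := height_le_of_not_deepOrd D hnd pp hp2 ⟨(pilotDataOfK D K).lstar - 1, htop⟩ x₀ hw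
  have hc : (((⟨(pilotDataOfK D K).lstar - 1, htop⟩ : Fin (thetaIndex (pilotDataOfK D K)).lstar) : ℕ) : ℝ) =
      ((pilotDataOfK D K).lstar : ℝ) - 1 := by
    rw [Fin.val_mk, Nat.cast_sub (by omega : 1 ≤ (pilotDataOfK D K).lstar), Nat.cast_one]
  rw [hc] at h
  convert h using 2 <;> ring

/-- **TOP-LABEL HEIGHT CEILING (certificate window `¬ Deep` on the chosen q-idele).** [cite: DupuyHilado2025, §3.3, §3.4]
[cite: Mochizuki2012, IUTchIV Prop. 1.2 p. 10] -/
theorem height_le_top_of_not_deep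
    (hnd : ¬ (∃ (pp : Nat.Primes) (_ : 2 < (pp : ℕ)) (i : Fin (thetaIndex (pilotDataOfK D K)).lstar)
        (x₀ : (thetaIndex (pilotDataOfK D K)).Fibre (.inr pp)),
      haveI : Fact (pp : ℕ).Prime := ⟨pp.2⟩
      ((pp : ℕ) : ℝ) ^ ((((i : ℕ) : ℝ) + 2) * (4 + 2 * Real.logb (pp : ℕ) (Module.finrank ℚ K)) + 1) *
        ‖(exists_realising_qIdeles_pilotDataOfK D).choose pp x₀‖ ^ (((i : ℕ) + 1) ^ 2 - 1) < 1))
    (pp : Nat.Primes) (hp2 : 2 < (pp : ℕ)) (x₀ : (thetaIndex (pilotDataOfK D K)).Fibre (.inr pp))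
    (hw : haveI : Fact (pp : ℕ).Prime := ⟨pp.2⟩; placeOf (pilotDataOfK D K) pp.1 x₀ ∈ (pilotDataOfK D K).S) :
    haveI : Fact (pp : ℕ).Prime := ⟨pp.2⟩
    ((((pilotDataOfK D K).lstar : ℝ)) ^ 2 - 1) * -((ord K (placeOf (pilotDataOfK D K) pp.1 x₀) (algebraMap F K E.j) : ℤ) : ℝ) ≤
      (2 * l * ramIdx K (placeOf (pilotDataOfK D K) pp.1 x₀) : ℝ) *
        ((((pilotDataOfK D K).lstar : ℝ) + 1) * (4 + 2 * Real.logb (pp : ℕ) (Module.finrank ℚ K)) + 1) :=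
  height_le_top_of_not_deepOrd D (fun h => hnd ((GenuineK.deep_iff_deepOrd D).mpr h)) pp hp2 x₀ hw

/-- **THE CEILING `H_win`, divided form.** Inside the window (datum-only form), at every bad place `x₀ | p > 2`:
`−ord_{x₀}(j_E) ≤ H_win(l, p, [K:ℚ], e_{x₀}) := 2l·e_{x₀}·((l⋇+1)(4+2·log_p[K:ℚ]) + 1)/(l⋇²−1)`.
[cite: DupuyHilado2025, §3.3, §3.4] [cite: Mochizuki2012, IUTchIV Prop. 1.2 p. 10] -/
theorem height_le_ceiling_of_not_deepOrd
    (hnd : ¬ (∃ (pp : Nat.Primes) (_ : 2 < (pp : ℕ)) (i : Fin (thetaIndex (pilotDataOfK D K)).lstar)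
        (x₀ : (thetaIndex (pilotDataOfK D K)).Fibre (.inr pp)),
      haveI : Fact (pp : ℕ).Prime := ⟨pp.2⟩
      placeOf (pilotDataOfK D K) pp.1 x₀ ∈ (pilotDataOfK D K).S ∧
      ((pp : ℕ) : ℝ) ^ ((((i : ℕ) : ℝ) + 2) * (4 + 2 * Real.logb (pp : ℕ) (Module.finrank ℚ K)) + 1) *
        (((pp : ℕ) : ℝ) ^ ((ord K (placeOf (pilotDataOfK D K) pp.1 x₀) (algebraMap F K E.j) : ℝ) /
          (2 * l * ramIdx K (placeOf (pilotDataOfK D K) pp.1 x₀)))) ^ (((i : ℕ) + 1) ^ 2 - 1) < 1))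
    (pp : Nat.Primes) (hp2 : 2 < (pp : ℕ)) (x₀ : (thetaIndex (pilotDataOfK D K)).Fibre (.inr pp))
    (hw : haveI : Fact (pp : ℕ).Prime := ⟨pp.2⟩; placeOf (pilotDataOfK D K) pp.1 x₀ ∈ (pilotDataOfK D K).S) :
    haveI : Fact (pp : ℕ).Prime := ⟨pp.2⟩
    (-((ord K (placeOf (pilotDataOfK D K) pp.1 x₀) (algebraMap F K E.j) : ℤ) : ℝ)) ≤
      (2 * l * ramIdx K (placeOf (pilotDataOfK D K) pp.1 x₀) : ℝ) *
          ((((pilotDataOfK D K).lstar : ℝ) + 1) * (4 + 2 * Real.logb (pp : ℕ) (Module.finrank ℚ K)) + 1) /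
        ((((pilotDataOfK D K).lstar : ℝ)) ^ 2 - 1) := by
  haveI : Fact (pp : ℕ).Prime := ⟨pp.2⟩
  have h2 : (2 : ℝ) ≤ ((pilotDataOfK D K).lstar : ℝ) := by exact_mod_cast (pilotDataOfK D K).two_le_lstar
  have hpos : (0 : ℝ) < (((pilotDataOfK D K).lstar : ℝ)) ^ 2 - 1 := by nlinarith
  rw [le_div_iff₀ hpos, mul_comm]
  exact height_le_top_of_not_deepOrd D hnd pp hp2 x₀ hw

/-- **TOP-LABEL CEILING IN TERMS OF `l`** (coarser closed form, `l = 2l⋇+1`): inside the window, at every bad place `x₀ | p > 2`,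
`(l−3)·(−ord_{x₀}(j_E)) ≤ 4l·e_{x₀}·(5 + 2·log_p[K:ℚ])` — from `(l⋇²−1) = (l−3)(l+1)/4`, `2l(l⋇+1) = l(l+1)` and `8/(l+1) ≤ 4`.
[cite: DupuyHilado2025, §3.3, §3.4] [cite: Mochizuki2012, IUTchIV Prop. 1.2 p. 10] -/
theorem height_le_of_not_deepOrd_l
    (hnd : ¬ (∃ (pp : Nat.Primes) (_ : 2 < (pp : ℕ)) (i : Fin (thetaIndex (pilotDataOfK D K)).lstar)
        (x₀ : (thetaIndex (pilotDataOfK D K)).Fibre (.inr pp)),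
      haveI : Fact (pp : ℕ).Prime := ⟨pp.2⟩
      placeOf (pilotDataOfK D K) pp.1 x₀ ∈ (pilotDataOfK D K).S ∧
      ((pp : ℕ) : ℝ) ^ ((((i : ℕ) : ℝ) + 2) * (4 + 2 * Real.logb (pp : ℕ) (Module.finrank ℚ K)) + 1) *
        (((pp : ℕ) : ℝ) ^ ((ord K (placeOf (pilotDataOfK D K) pp.1 x₀) (algebraMap F K E.j) : ℝ) /
          (2 * l * ramIdx K (placeOf (pilotDataOfK D K) pp.1 x₀)))) ^ (((i : ℕ) + 1) ^ 2 - 1) < 1))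
    (pp : Nat.Primes) (hp2 : 2 < (pp : ℕ)) (x₀ : (thetaIndex (pilotDataOfK D K)).Fibre (.inr pp))
    (hw : haveI : Fact (pp : ℕ).Prime := ⟨pp.2⟩; placeOf (pilotDataOfK D K) pp.1 x₀ ∈ (pilotDataOfK D K).S) :
    haveI : Fact (pp : ℕ).Prime := ⟨pp.2⟩
    ((l : ℝ) - 3) * -((ord K (placeOf (pilotDataOfK D K) pp.1 x₀) (algebraMap F K E.j) : ℤ) : ℝ) ≤
      4 * l * ramIdx K (placeOf (pilotDataOfK D K) pp.1 x₀) * (5 + 2 * Real.logb (pp : ℕ) (Module.finrank ℚ K)) := by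
  haveI : Fact (pp : ℕ).Prime := ⟨pp.2⟩
  have h := height_le_top_of_not_deepOrd D hnd pp hp2 x₀ hw
  -- abbreviations: s = l⋇, H = −ord, e = e_{x₀}, c = 4 + 2·log_p N
  set s : ℝ := ((pilotDataOfK D K).lstar : ℝ) with hs
  set H : ℝ := -((ord K (placeOf (pilotDataOfK D K) pp.1 x₀) (algebraMap F K E.j) : ℤ) : ℝ) with hH
  set e : ℝ := (ramIdx K (placeOf (pilotDataOfK D K) pp.1 x₀) : ℝ) with he
  set c : ℝ := 4 + 2 * Real.logb (pp : ℕ) (Module.finrank ℚ K) with hc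
  have hl : (l : ℝ) = 2 * s + 1 := by
    have := (pilotDataOfK D K).l_cast
    rwa [pilotDataOfK_l] at this
  have h2 : (2 : ℝ) ≤ s := by rw [hs]; exact_mod_cast (pilotDataOfK D K).two_le_lstar
  have hHpos : 0 ≤ H := by
    have hj : ord K (placeOf (pilotDataOfK D K) pp.1 x₀) (algebraMap F K E.j) < 0 := by
      have h' := (pilotDataOfK D K).ord_jE_neg _ hw
      rwa [show (pilotDataOfK D K).jE = algebraMap F K E.j from rfl] at h'
    have : ((ord K (placeOf (pilotDataOfK D K) pp.1 x₀) (algebraMap F K E.j) : ℤ) : ℝ) < 0 := by exact_mod_cast hj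
    rw [hH]; linarith
  have hepos : 0 ≤ e := by rw [he]; positivity
  have hcpos : 0 ≤ c := by
    have hN : (1 : ℝ) ≤ (Module.finrank ℚ K : ℝ) := by exact_mod_cast Module.finrank_pos
    have : 0 ≤ Real.logb (pp : ℕ) (Module.finrank ℚ K) := Real.logb_nonneg (by exact_mod_cast pp.2.one_lt) hN
    rw [hc]; linarith
  have hlpos : 0 ≤ (l : ℝ) := by rw [hl]; linarith
  -- `h : (s²−1)·H ≤ 2·l·e·((s+1)·c + 1)`; goal `(l−3)·H ≤ 4·l·e·(c+1)` with `l = 2s+1`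
  have hs0 : 0 ≤ s := by linarith
  have h2le : 0 ≤ 2 * (l : ℝ) * e := mul_nonneg (mul_nonneg (by norm_num) hlpos) hepos
  have h' : (s + 1) * ((s - 1) * H) ≤ (s + 1) * (2 * l * e * (c + 1)) := by
    have h1 : (s + 1) * ((s - 1) * H) = (s ^ 2 - 1) * H := by ring
    have h3 : 2 * (l : ℝ) * e * ((s + 1) * c + 1) ≤ (s + 1) * (2 * l * e * (c + 1)) := by
      have hx : (s + 1) * (2 * (l : ℝ) * e * (c + 1)) - 2 * l * e * ((s + 1) * c + 1) = 2 * l * e * s := by ring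
      have hy : 0 ≤ 2 * (l : ℝ) * e * s := mul_nonneg h2le hs0
      linarith
    rw [h1]
    exact h.trans h3
  have h'' : (s - 1) * H ≤ 2 * l * e * (c + 1) := le_of_mul_le_mul_left h' (by linarith)
  rw [hl] at h'' ⊢
  rw [hc] at h''
  linarith

/-! ## §3. The R-H reading: an in-window PLACE-cut whose threshold dominates the ceiling is no cut at all -/

/-- **PLACE-CUT TOTAL INSIDE THE WINDOW.** Let `Q p x₀` be any per-place clause (e.g. the honest I06⋆ data-cells of the place, or an (Ind2)-mover
there) and suppose a PLACE-cut candidate supplies `Q` only at the bad places `x₀ | p > 2` whose height satisfies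
`(l⋇²−1)·(−ord_{x₀}(j_E)) ≤ θ p x₀` for a threshold `θ` dominating the window's `2l·e_{x₀}·((l⋇+1)(4+2·log_p[K:ℚ]) + 1)`. Then inside the
window the candidate supplies `Q` at EVERY bad place over every odd prime: the cut is automatic (`height_le_top_of_not_deepOrd`).
[cite: DupuyHilado2025, §3.3, §3.4] [cite: Mochizuki2012, IUTchIV Prop. 1.2 p. 10] -/
theorem placeCut_total_of_not_deepOrd
    (Q : ∀ pp : Nat.Primes, (thetaIndex (pilotDataOfK D K)).Fibre (.inr pp) → Prop)
    (θ : ∀ pp : Nat.Primes, (thetaIndex (pilotDataOfK D K)).Fibre (.inr pp) → ℝ)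
    (hθ : ∀ (pp : Nat.Primes) (x₀ : (thetaIndex (pilotDataOfK D K)).Fibre (.inr pp)), 2 < (pp : ℕ) →
      haveI : Fact (pp : ℕ).Prime := ⟨pp.2⟩
      (2 * l * ramIdx K (placeOf (pilotDataOfK D K) pp.1 x₀) : ℝ) *
          ((((pilotDataOfK D K).lstar : ℝ) + 1) * (4 + 2 * Real.logb (pp : ℕ) (Module.finrank ℚ K)) + 1) ≤ θ pp x₀)
    (hcut : ∀ (pp : Nat.Primes) (x₀ : (thetaIndex (pilotDataOfK D K)).Fibre (.inr pp)), 2 < (pp : ℕ) →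
      haveI : Fact (pp : ℕ).Prime := ⟨pp.2⟩
      placeOf (pilotDataOfK D K) pp.1 x₀ ∈ (pilotDataOfK D K).S →
      ((((pilotDataOfK D K).lstar : ℝ)) ^ 2 - 1) * -((ord K (placeOf (pilotDataOfK D K) pp.1 x₀) (algebraMap F K E.j) : ℤ) : ℝ) ≤
        θ pp x₀ → Q pp x₀)
    (hnd : ¬ (∃ (pp : Nat.Primes) (_ : 2 < (pp : ℕ)) (i : Fin (thetaIndex (pilotDataOfK D K)).lstar)
        (x₀ : (thetaIndex (pilotDataOfK D K)).Fibre (.inr pp)),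
      haveI : Fact (pp : ℕ).Prime := ⟨pp.2⟩
      placeOf (pilotDataOfK D K) pp.1 x₀ ∈ (pilotDataOfK D K).S ∧
      ((pp : ℕ) : ℝ) ^ ((((i : ℕ) : ℝ) + 2) * (4 + 2 * Real.logb (pp : ℕ) (Module.finrank ℚ K)) + 1) *
        (((pp : ℕ) : ℝ) ^ ((ord K (placeOf (pilotDataOfK D K) pp.1 x₀) (algebraMap F K E.j) : ℝ) /
          (2 * l * ramIdx K (placeOf (pilotDataOfK D K) pp.1 x₀)))) ^ (((i : ℕ) + 1) ^ 2 - 1) < 1))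
    (pp : Nat.Primes) (hp2 : 2 < (pp : ℕ)) (x₀ : (thetaIndex (pilotDataOfK D K)).Fibre (.inr pp))
    (hw : haveI : Fact (pp : ℕ).Prime := ⟨pp.2⟩; placeOf (pilotDataOfK D K) pp.1 x₀ ∈ (pilotDataOfK D K).S) :
    Q pp x₀ :=
  hcut pp x₀ hp2 hw ((height_le_top_of_not_deepOrd D hnd pp hp2 x₀ hw).trans (hθ pp x₀ hp2))

end PerDatum

end Summit.ABC.IUTFork.Repair.RHPlaceCutHeightCeiling

end
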